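import Mathlib
import Summits.ValiantsHypothesis.ValiantsHypothesis.Theorems.GeneratorObstructionsGenFlipThesisSliceTransfer
import Literature.Computability.AlgebraicComplexity.StandardFamiliesProofs

/-!
# Route GeneratorObstructions — generator COUNTS are placement invariants (γ-equality under
# inheritance; strengthening of `GenInheritance`, stmt-ValiantsHypothesis-11659, for the lines of the
# crux `GenFlipThesis`, stmt-ValiantsHypothesis-11653)

Helper file (`--supports stmt-ValiantsHypothesis-11653`).  The landed inheritance theorem
(`GenInheritance.finrank_ne_zero_rename_of_strictMono`, BLMW 2011 §5.4) transfers NON-VANISHING of the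
generator count `γ_χ(f) = dim HWV_χ(k[Δ_m f]) ⧸ (HWV_χ ∩ Σ HWV_χ₁·HWV_χ₂)` to `γ_{ext_ι χ}(ι f)` for a
final-segment embedding `ι` of the letters.  Here the same pull-back `Φ : k[Δ_m f] → k[Δ_m (ι f)]`
(injective, `Φ(HWV_χ) = HWV_{ext χ}`, splittings of `ext χ` come from `σ`) is shown to give EQUALITY
of counts:

* `finrank_quotient_eq_of_map_eq` — abstract: under the hypotheses of
  `GenInheritanceBase.not_le_decomposable_of_map_eq`, `Φ` maps the decomposable part ONTO the
  decomposable part, so the quotients are isomorphic;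
* `finrank_eq_of_orbitVanishingIdeal_eq` — forms with the same vanishing ideal (e.g. one `GL`-orbit)
  have equal `γ_χ`;
* `finrank_rename_eq_of_strictMono` — `γ_{ext_ι χ}(rename ι f) = γ_χ(f)` for `ι` strictly monotone
  onto an upper set;
* `finrank_rename_eq_of_injective` — for ANY injective placement `κ` of the letters,
  `γ_{ext_ι χ}(rename κ f) = γ_χ(f)` with `ι` the final segment (conjugate placements).

So the slice generator counts of a placed form are literally the own-variable counts (e.g. for the
block permanent of the route's `GenFlipThesis`), not merely nonzero together.  Characteristic zero,
`f ≠ 0` homogeneous of degree `m` (no `m ≠ 0` needed for the equalities).  Honest framing: bookkeeping; no open item is closed and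
nothing here bears on `VP ≠ VNP`.

References: Bürgisser–Landsberg–Manivel–Weyman, SIAM J. Comput. 40 (2011) §5.4; Landsberg,
*Geometry and Complexity Theory* (2017) §8.4.1 (inheritance).
-/

namespace Summit.ValiantsHypothesis.ValiantsHypothesis.Theorems.GeneratorObstructions.GammaEquality

open MvPolynomial
open Literature.NumberTheory.DiophantineGeometry Literature.Computability.AlgebraicComplexity
open Summit.ValiantsHypothesis.ValiantsHypothesis.Theorems.GenInheritance
open Summit.ValiantsHypothesis.ValiantsHypothesis.Theorems.GeneratorObstructions.SliceTransfer

-- `Summit.ValiantsHypothesis.ValiantsHypothesis.…` is the tree's mandated single-conjunct layout.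
set_option linter.dupNamespace false

noncomputable section

/-! ## 1. Abstract: the pull-back identifies the quotients by the decomposable parts -/

section Abstract

variable {k : Type*} [Field k] {σ τ : Type*} [Fintype σ] [LinearOrder σ] [Fintype τ] [LinearOrder τ]
  {A A' : Type*} [CommRing A] [Algebra k A] [CommRing A'] [Algebra k A']

/-- **The decomposable part maps ONTO the decomposable part.** Under the hypotheses of
`not_le_decomposable_of_map_eq` (injective algebra map `Φ` with `Φ(HWV_χ) = HWV_{ext χ}` for an
injective additive `ext`, splittings of `ext χ` into occurring weights come from `σ`),
`Φ(Σ_{χ₁+χ₂=χ} HWV_χ₁·HWV_χ₂) = Σ_{ψ₁+ψ₂=ext χ} HWV_ψ₁·HWV_ψ₂`. [folklore] -/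
theorem map_decomposable_eq
    (ρ : Representation k (GL σ k) A) (ρ' : Representation k (GL τ k) A')
    (Φ : A →ₐ[k] A') (ext : Weight σ → Weight τ) (hadd : ∀ a b, ext (a + b) = ext a + ext b)
    (hinj : Function.Injective ext)
    (H1 : ∀ χ : Weight σ, (highestWeightSpace ρ χ).map Φ.toLinearMap = highestWeightSpace ρ' (ext χ))
    (χ : Weight σ)
    (H2 : ∀ ψ₁ ψ₂ : Weight τ, ψ₁ + ψ₂ = ext χ → highestWeightSpace ρ' ψ₁ ≠ ⊥ →
      highestWeightSpace ρ' ψ₂ ≠ ⊥ → ∃ χ₁, ext χ₁ = ψ₁) :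
    (⨆ p : Weight σ × Weight σ, ⨆ (_ : p.1 + p.2 = χ ∧ p.1 ≠ 0 ∧ p.2 ≠ 0),
        highestWeightSpace ρ p.1 * highestWeightSpace ρ p.2).map Φ.toLinearMap =
      ⨆ p : Weight τ × Weight τ, ⨆ (_ : p.1 + p.2 = ext χ ∧ p.1 ≠ 0 ∧ p.2 ≠ 0),
        highestWeightSpace ρ' p.1 * highestWeightSpace ρ' p.2 := by
  have hext0 : ext 0 = 0 := by
    have h00 := hadd 0 0
    rw [add_zero] at h00
    exact left_eq_add.mp h00
  apply le_antisymm
  · rw [Submodule.map_iSup]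
    refine iSup_le fun p => ?_
    rw [Submodule.map_iSup]
    refine iSup_le fun hp => ?_
    obtain ⟨hsum, hp1, hp2⟩ := hp
    rw [Submodule.map_mul, H1, H1]
    refine le_iSup_of_le (ext p.1, ext p.2) (le_iSup_of_le ⟨by rw [← hadd, hsum], ?_, ?_⟩ le_rfl)
    · exact fun h0 => hp1 (hinj (h0.trans hext0.symm))
    · exact fun h0 => hp2 (hinj (h0.trans hext0.symm))
  · refine iSup_le fun p => iSup_le fun hp => ?_
    obtain ⟨hsum, hp1, hp2⟩ := hp
    by_cases hb1 : highestWeightSpace ρ' p.1 = ⊥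
    · rw [hb1, Submodule.bot_mul]; exact bot_le
    by_cases hb2 : highestWeightSpace ρ' p.2 = ⊥
    · rw [hb2, Submodule.mul_bot]; exact bot_le
    obtain ⟨χ₁, hχ₁⟩ := H2 p.1 p.2 hsum hb1 hb2
    obtain ⟨χ₂, hχ₂⟩ := H2 p.2 p.1 ((add_comm _ _).trans hsum) hb2 hb1
    have hχ : χ₁ + χ₂ = χ := hinj (by rw [hadd, hχ₁, hχ₂, hsum])
    have hχ₁0 : χ₁ ≠ 0 := fun h0 => hp1 (by rw [← hχ₁, h0, hext0])
    have hχ₂0 : χ₂ ≠ 0 := fun h0 => hp2 (by rw [← hχ₂, h0, hext0])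
    rw [← hχ₁, ← hχ₂, ← H1 χ₁, ← H1 χ₂, ← Submodule.map_mul]
    refine Submodule.map_mono ?_
    exact le_iSup_of_le (χ₁, χ₂) (le_iSup_of_le ⟨hχ, hχ₁0, hχ₂0⟩ le_rfl)

/-- **Equality of generator counts along the pull-back.** With the hypotheses of
`map_decomposable_eq` and `Φ` injective, `Φ` restricts to a linear isomorphism
`HWV_χ(A) ≃ HWV_{ext χ}(A')` carrying `HWV_χ ∩ (decomposables)` onto `HWV_{ext χ} ∩ (decomposables)`,
so `dim HWV_{ext χ} ⧸ (…) = dim HWV_χ ⧸ (…)`. [folklore] -/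
theorem finrank_quotient_eq_of_map_eq
    (ρ : Representation k (GL σ k) A) (ρ' : Representation k (GL τ k) A')
    (Φ : A →ₐ[k] A') (hΦ : Function.Injective Φ)
    (ext : Weight σ → Weight τ) (hadd : ∀ a b, ext (a + b) = ext a + ext b)
    (hinj : Function.Injective ext)
    (H1 : ∀ χ : Weight σ, (highestWeightSpace ρ χ).map Φ.toLinearMap = highestWeightSpace ρ' (ext χ))
    (χ : Weight σ)
    (H2 : ∀ ψ₁ ψ₂ : Weight τ, ψ₁ + ψ₂ = ext χ → highestWeightSpace ρ' ψ₁ ≠ ⊥ →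
      highestWeightSpace ρ' ψ₂ ≠ ⊥ → ∃ χ₁, ext χ₁ = ψ₁) :
    Module.finrank k (↥(highestWeightSpace ρ' (ext χ)) ⧸
      Submodule.comap (highestWeightSpace ρ' (ext χ)).subtype
        (⨆ p : Weight τ × Weight τ, ⨆ (_ : p.1 + p.2 = ext χ ∧ p.1 ≠ 0 ∧ p.2 ≠ 0),
          highestWeightSpace ρ' p.1 * highestWeightSpace ρ' p.2)) =
    Module.finrank k (↥(highestWeightSpace ρ χ) ⧸
      Submodule.comap (highestWeightSpace ρ χ).subtype
        (⨆ p : Weight σ × Weight σ, ⨆ (_ : p.1 + p.2 = χ ∧ p.1 ≠ 0 ∧ p.2 ≠ 0),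
          highestWeightSpace ρ p.1 * highestWeightSpace ρ p.2)) := by
  set S := highestWeightSpace ρ χ with hS
  set S' := highestWeightSpace ρ' (ext χ) with hS'
  set D := (⨆ p : Weight σ × Weight σ, ⨆ (_ : p.1 + p.2 = χ ∧ p.1 ≠ 0 ∧ p.2 ≠ 0),
    highestWeightSpace ρ p.1 * highestWeightSpace ρ p.2) with hD
  set D' := (⨆ p : Weight τ × Weight τ, ⨆ (_ : p.1 + p.2 = ext χ ∧ p.1 ≠ 0 ∧ p.2 ≠ 0),
    highestWeightSpace ρ' p.1 * highestWeightSpace ρ' p.2) with hD'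
  have hDmap : D.map Φ.toLinearMap = D' := map_decomposable_eq ρ ρ' Φ ext hadd hinj H1 χ H2
  have hSmap : S.map Φ.toLinearMap = S' := H1 χ
  -- the linear isomorphism `S ≃ S'` induced by `Φ`
  let e : S ≃ₗ[k] S' :=
    (Submodule.equivMapOfInjective Φ.toLinearMap hΦ S).trans (LinearEquiv.ofEq _ _ hSmap)
  have he : ∀ x : S, (e x : A') = Φ x := fun x => rfl
  -- it carries `S ∩ D` onto `S' ∩ D'`
  have hcomap : (D.comap S.subtype).map (e : S →ₗ[k] S') = D'.comap S'.subtype := by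
    ext y
    simp only [Submodule.mem_map, Submodule.mem_comap, Submodule.subtype_apply]
    constructor
    · rintro ⟨x, hx, rfl⟩
      rw [LinearEquiv.coe_coe, he, ← hDmap]
      exact Submodule.mem_map_of_mem hx
    · intro hy
      refine ⟨e.symm y, ?_, e.apply_symm_apply y⟩
      have hy' : (y : A') ∈ D.map Φ.toLinearMap := by rw [hDmap]; exact hy
      obtain ⟨w, hw, hwy⟩ := Submodule.mem_map.mp hy'
      have hxy : Φ (e.symm y : A) = (y : A') := by
        rw [← he, e.apply_symm_apply]
      have hwx : w = (e.symm y : A) := hΦ (hwy.trans hxy.symm)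
      rw [← hwx]
      exact hw
  exact (Submodule.Quotient.equiv (D.comap S.subtype) (D'.comap S'.subtype) e hcomap).finrank_eq.symm

end Abstract

/-! ## 2. Concrete: orbit transport and renaming along a final segment -/

section Concrete

variable {k : Type*} [Field k] {σ τ : Type*} [Fintype σ] [LinearOrder σ] [Fintype τ] [LinearOrder τ]
  {m : ℕ}

/-- **`γ_χ` only depends on the vanishing ideal** (equality version of
`GenInheritanceBase.finrank_ne_zero_of_orbitVanishingIdeal_eq`): the canonical equivariant algebra
isomorphism of the coordinate rings identifies highest-weight spaces and decomposable parts.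
[folklore] -/
theorem finrank_eq_of_orbitVanishingIdeal_eq {f₁ f₂ : MvPolynomial τ k}
    (hI : orbitVanishingIdeal f₁ m = orbitVanishingIdeal f₂ m) (χ : Weight τ) :
    Module.finrank k (↥(highestWeightSpace (orbitCoordRep f₂ m) χ) ⧸
      Submodule.comap (highestWeightSpace (orbitCoordRep f₂ m) χ).subtype
        (⨆ p : Weight τ × Weight τ, ⨆ (_ : p.1 + p.2 = χ ∧ p.1 ≠ 0 ∧ p.2 ≠ 0),
          highestWeightSpace (orbitCoordRep f₂ m) p.1 * highestWeightSpace (orbitCoordRep f₂ m) p.2)) =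
    Module.finrank k (↥(highestWeightSpace (orbitCoordRep f₁ m) χ) ⧸
      Submodule.comap (highestWeightSpace (orbitCoordRep f₁ m) χ).subtype
        (⨆ p : Weight τ × Weight τ, ⨆ (_ : p.1 + p.2 = χ ∧ p.1 ≠ 0 ∧ p.2 ≠ 0),
          highestWeightSpace (orbitCoordRep f₁ m) p.1 * highestWeightSpace (orbitCoordRep f₁ m) p.2)) := by
  set Φ := Ideal.quotientEquivAlgOfEq k hI with hΦdef
  have hΦ : ∀ F, Φ (Ideal.Quotient.mk _ F) = Ideal.Quotient.mk _ F := fun F =>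
    Ideal.quotientEquivAlgOfEq_mk k hI F
  have hequiv : ∀ (g : GL τ k) (x : OrbitCoordRing f₁ m),
      orbitCoordRep f₂ m g (Φ x) = Φ (orbitCoordRep f₁ m g x) := by
    intro g x
    obtain ⟨F, rfl⟩ := Ideal.Quotient.mk_surjective x
    rw [hΦ, orbitCoordRep_apply, orbitCoordSubst_mk, orbitCoordRep_apply, orbitCoordSubst_mk, hΦ]
  have H1 : ∀ χ' : Weight τ, (highestWeightSpace (orbitCoordRep f₁ m) χ').map Φ.toAlgHom.toLinearMap =
      highestWeightSpace (orbitCoordRep f₂ m) (id χ') := by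
    intro χ'
    apply le_antisymm
    · rintro _ ⟨x, hx, rfl⟩ b hb
      change orbitCoordRep f₂ m b (Φ x) = _ • Φ x
      rw [hequiv, hx b hb, map_smul]
      rfl
    · intro y hy
      refine ⟨Φ.symm y, fun b hb => Φ.injective ?_, Φ.apply_symm_apply y⟩
      rw [← hequiv, AlgEquiv.apply_symm_apply, hy b hb, map_smul, AlgEquiv.apply_symm_apply]
      rfl
  exact finrank_quotient_eq_of_map_eq (orbitCoordRep f₁ m) (orbitCoordRep f₂ m) Φ.toAlgHom
    Φ.injective id (fun _ _ => rfl) Function.injective_id H1 χ (fun ψ₁ _ _ _ _ => ⟨ψ₁, rfl⟩)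

variable {ι : σ → τ}

/-- **γ-equality under inheritance**: for `ι` strictly monotone onto an upper set of letters, a
nonzero form `f` of degree `m` (characteristic zero) and every weight `χ`,
`γ_{ext_ι χ}(rename ι f) = γ_χ(f)` — the generator counts of the algebra of highest-weight vectors
are inherited exactly, not only their non-vanishing (`finrank_ne_zero_rename_of_strictMono`).
BLMW 2011 §5.4. [folklore] -/
theorem finrank_rename_eq_of_strictMono [CharZero k] (hι : StrictMono ι)
    (hup : IsUpperSet (Set.range ι)) {f : MvPolynomial σ k} (hf : f.IsHomogeneous m) (hf0 : f ≠ 0)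
    (χ : Weight σ) :
    Module.finrank k (↥(highestWeightSpace (orbitCoordRep (rename ι f) m) (Function.extend ι χ 0)) ⧸
      Submodule.comap (highestWeightSpace (orbitCoordRep (rename ι f) m) (Function.extend ι χ 0)).subtype
        (⨆ p : Weight τ × Weight τ, ⨆ (_ : p.1 + p.2 = Function.extend ι χ 0 ∧ p.1 ≠ 0 ∧ p.2 ≠ 0),
          highestWeightSpace (orbitCoordRep (rename ι f) m) p.1 *
            highestWeightSpace (orbitCoordRep (rename ι f) m) p.2)) =
    Module.finrank k (↥(highestWeightSpace (orbitCoordRep f m) χ) ⧸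
      Submodule.comap (highestWeightSpace (orbitCoordRep f m) χ).subtype
        (⨆ p : Weight σ × Weight σ, ⨆ (_ : p.1 + p.2 = χ ∧ p.1 ≠ 0 ∧ p.2 ≠ 0),
          highestWeightSpace (orbitCoordRep f m) p.1 * highestWeightSpace (orbitCoordRep f m) p.2)) := by
  obtain ⟨Φ, hΦ⟩ := exists_algHom_rename hι.injective hf hf0
  exact finrank_quotient_eq_of_map_eq (orbitCoordRep f m) (orbitCoordRep (rename ι f) m) Φ
    (injective_of_apply_mk_eq hι.injective hf hf0 Φ hΦ) (fun χ => Function.extend ι χ 0)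
    (extend_add hι.injective) (extend_injective hι.injective)
    (map_highestWeightSpace_eq_of_apply_mk_eq hι hup Φ hΦ) χ
    (fun ψ₁ ψ₂ hsum h₁ h₂ => ⟨ψ₁ ∘ ι, extend_comp_eq_of_add_eq_extend hι.injective h₁ h₂ hsum⟩)

/-- **γ-equality for any placement of the letters**: for an injection `κ : σ → τ`, the final segment
`ι : σ → τ` and a nonzero form `f` of degree `m`, `γ_{ext_ι χ}(rename κ f) = γ_χ(f)` — the two
placements are conjugate under a permutation matrix (`rename_mem_glOrbit_rename_of_injective`), so
their coordinate rings have the same vanishing ideal (`finrank_eq_of_orbitVanishingIdeal_eq`), and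
`finrank_rename_eq_of_strictMono` applies to `ι`. [folklore] -/
theorem finrank_rename_eq_of_injective [CharZero k] (κ : σ → τ) (hκ : Function.Injective κ)
    (hι : StrictMono ι) (hup : IsUpperSet (Set.range ι)) {f : MvPolynomial σ k}
    (hf : f.IsHomogeneous m) (hf0 : f ≠ 0) (χ : Weight σ) :
    Module.finrank k (↥(highestWeightSpace (orbitCoordRep (rename κ f) m) (Function.extend ι χ 0)) ⧸
      Submodule.comap (highestWeightSpace (orbitCoordRep (rename κ f) m) (Function.extend ι χ 0)).subtype
        (⨆ p : Weight τ × Weight τ, ⨆ (_ : p.1 + p.2 = Function.extend ι χ 0 ∧ p.1 ≠ 0 ∧ p.2 ≠ 0),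
          highestWeightSpace (orbitCoordRep (rename κ f) m) p.1 *
            highestWeightSpace (orbitCoordRep (rename κ f) m) p.2)) =
    Module.finrank k (↥(highestWeightSpace (orbitCoordRep f m) χ) ⧸
      Submodule.comap (highestWeightSpace (orbitCoordRep f m) χ).subtype
        (⨆ p : Weight σ × Weight σ, ⨆ (_ : p.1 + p.2 = χ ∧ p.1 ≠ 0 ∧ p.2 ≠ 0),
          highestWeightSpace (orbitCoordRep f m) p.1 * highestWeightSpace (orbitCoordRep f m) p.2)) := by
  classical
  rw [finrank_eq_of_orbitVanishingIdeal_eq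
    (orbitVanishingIdeal_eq_of_mem_glOrbit
      (rename_mem_glOrbit_rename_of_injective κ ι hκ hι.injective f) m) (Function.extend ι χ 0)]
  exact finrank_rename_eq_of_strictMono hι hup hf hf0 χ

end Concrete

/-! ## 3. The route's placements: the block permanent -/

section Per

/-- **Block placement of the permanent**: for the final segment `ι : MatIdx m → MatIdx (m+e)`
and every weight `χ` of `GL_{m²}`, the generator count of type `ext_ι χ` of
`A(Δ_m[per_m on the top-left block of the (m+e)×(m+e) matrix])` EQUALS the generator count of type
`χ` of `A(Δ_m[per_m])` in its own variables (the quantities compared in the route's `GenFlipThesis`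
and `PerGenDegreeSuperQP`). [folklore] -/
theorem finrank_blockPer_eq (m e : ℕ) {ι : MatIdx m → MatIdx (m + e)}
    (hι : StrictMono ι) (hup : IsUpperSet (Set.range ι)) (χ : Weight (MatIdx m)) :
    Module.finrank ℂ (↥(highestWeightSpace (orbitCoordRep (MvPolynomial.rename (fun ij : Fin m × Fin m => toLex (Fin.castAdd e ij.1, Fin.castAdd e ij.2)) (perPoly (Fin m) ℂ)) m) (Function.extend ι χ 0)) ⧸ Submodule.comap (highestWeightSpace (orbitCoordRep (MvPolynomial.rename (fun ij : Fin m × Fin m => toLex (Fin.castAdd e ij.1, Fin.castAdd e ij.2)) (perPoly (Fin m) ℂ)) m) (Function.extend ι χ 0)).subtype (⨆ p : Weight (MatIdx (m + e)) × Weight (MatIdx (m + e)), ⨆ (_ : p.1 + p.2 = (Function.extend ι χ 0) ∧ p.1 ≠ 0 ∧ p.2 ≠ 0), highestWeightSpace (orbitCoordRep (MvPolynomial.rename (fun ij : Fin m × Fin m => toLex (Fin.castAdd e ij.1, Fin.castAdd e ij.2)) (perPoly (Fin m) ℂ)) m) p.1 * highestWeightSpace (orbitCoordRep (MvPolynomial.rename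 (fun ij : Fin m × Fin m => toLex (Fin.castAdd e ij.1, Fin.castAdd e ij.2)) (perPoly (Fin m) ℂ)) m) p.2)) =
    Module.finrank ℂ (↥(highestWeightSpace (orbitCoordRep (MvPolynomial.rename toLex (perPoly (Fin m) ℂ)) m) χ) ⧸ Submodule.comap (highestWeightSpace (orbitCoordRep (MvPolynomial.rename toLex (perPoly (Fin m) ℂ)) m) χ).subtype (⨆ p : Weight (MatIdx m) × Weight (MatIdx m), ⨆ (_ : p.1 + p.2 = χ ∧ p.1 ≠ 0 ∧ p.2 ≠ 0), highestWeightSpace (orbitCoordRep (MvPolynomial.rename toLex (perPoly (Fin m) ℂ)) m) p.1 * highestWeightSpace (orbitCoordRep (MvPolynomial.rename toLex (perPoly (Fin m) ℂ)) m) p.2)) := by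
  have hf : (rename toLex (perPoly (Fin m) ℂ) : MvPolynomial (MatIdx m) ℂ).IsHomogeneous m := by
    simpa using (perPoly_isHomogeneous (n := Fin m) (k := ℂ)).rename_isHomogeneous
      (f := (toLex : Fin m × Fin m → MatIdx m))
  have hf0 : (rename toLex (perPoly (Fin m) ℂ) : MvPolynomial (MatIdx m) ℂ) ≠ 0 :=
    (map_ne_zero_iff _ (rename_injective _ toLex.injective)).mpr (perPoly_ne_zero (Fin m) ℂ)
  have hκ : Function.Injective fun x : MatIdx m =>
      (toLex (Fin.castAdd e (ofLex x).1, Fin.castAdd e (ofLex x).2) : MatIdx (m + e)) := by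
    intro x y hxy
    have h1 := toLex.injective hxy
    rw [Prod.mk.injEq] at h1
    exact ofLex.injective (Prod.ext (Fin.castAdd_injective _ _ h1.1) (Fin.castAdd_injective _ _ h1.2))
  have key := finrank_rename_eq_of_injective (m := m) _ hκ hι hup hf hf0 χ
  rw [rename_rename] at key
  exact key

end Per

/-! ## 4. Quantitative transfer: generator COUNTS go up along degenerations onto the slice -/

section Quantitative

/-- **Quantitative slice transfer.** For `ι : σ → τ` strictly monotone onto an upper set, a nonzero
form `g₀` of degree `m ≠ 0` in the letters `σ` with `rename ι g₀ ∈ Δ(f)`, and every weight `χ`: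
`γ_χ(g₀) ≤ γ_{ext_ι χ}(f)` — the generator count of `A(Δ g₀)` at `χ` is a lower bound for the slice
generator count of `A(Δ f)` at `ext_ι χ` (γ-equality `finrank_rename_eq_of_strictMono` followed by
the generator-obstruction principle `genPrinciple_proof`).  With `f = tr X_n^m` and `g₀` any qp-easy
`m²`-variate form (e.g. `x₁₁⋯x_mm`, `det_m`), and with `finrank_blockPer_eq` on the permanent side,
this is the count-level form of the comparison made in `GenFlipThesis`. [folklore] -/
theorem finrank_le_finrank_extend_of_rename_mem_orbitClosure {σ τ : Type} [Fintype σ] [LinearOrder σ]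
    [Fintype τ] [LinearOrder τ] {ι : σ → τ} (hι : StrictMono ι) (hup : IsUpperSet (Set.range ι))
    {g₀ : MvPolynomial σ ℂ} {f : MvPolynomial τ ℂ} {m : ℕ} (hg₀ : g₀.IsHomogeneous m) (hg₀0 : g₀ ≠ 0)
    (hm : m ≠ 0) (hmem : rename ι g₀ ∈ orbitClosure f) (χ : Weight σ) :
    Module.finrank ℂ (↥(highestWeightSpace (orbitCoordRep g₀ m) χ) ⧸
      Submodule.comap (highestWeightSpace (orbitCoordRep g₀ m) χ).subtype
        (⨆ p : Weight σ × Weight σ, ⨆ (_ : p.1 + p.2 = χ ∧ p.1 ≠ 0 ∧ p.2 ≠ 0),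
          highestWeightSpace (orbitCoordRep g₀ m) p.1 * highestWeightSpace (orbitCoordRep g₀ m) p.2)) ≤
    Module.finrank ℂ (↥(highestWeightSpace (orbitCoordRep f m) (Function.extend ι χ 0)) ⧸
      Submodule.comap (highestWeightSpace (orbitCoordRep f m) (Function.extend ι χ 0)).subtype
        (⨆ p : Weight τ × Weight τ, ⨆ (_ : p.1 + p.2 = Function.extend ι χ 0 ∧ p.1 ≠ 0 ∧ p.2 ≠ 0),
          highestWeightSpace (orbitCoordRep f m) p.1 * highestWeightSpace (orbitCoordRep f m) p.2)) := by
  rw [← finrank_rename_eq_of_strictMono hι hup hg₀ hg₀0 χ]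
  exact Summit.ValiantsHypothesis.ValiantsHypothesis.Theorems.GeneratorObstructionsGenPrinciple.genPrinciple_proof
    f (rename ι g₀) m hm hmem _

end Quantitative

/-! ## 5. `GenFlipThesis` from a flip read in the permanent's OWN variables -/

section OwnFlip

open Summit.ValiantsHypothesis.ValiantsHypothesis.Theses.GeneratorObstructions

/-- **`GenFlipThesis` from an own-variables flip.**  If for every `c, m₀` there is `m ≥ max(m₀,1)`
such that at every size `n = m + e` of the window some weight `χ` of `GL_{m²}` has
`γ_{ext_ι χ}(tr X_n^m) < γ_χ(per_m)` — the trace side read at the final-segment weight, the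
permanent side read in its OWN `m²` variables — then the route's crux `GenFlipThesis` holds: by
`finrank_blockPer_eq` the own-variable count equals the count of the block permanent at `ext_ι χ`.
(So flips may be searched among slice weights with `A(Δ per_m)` computed once, in `m²` variables.)
[folklore] -/
theorem genFlipThesis_of_ownFlip
    (h : ∀ c m₀ : ℕ, ∃ m : ℕ, m₀ ≤ m ∧ 1 ≤ m ∧ ∀ e : ℕ, m + e ≤ 2 ^ ((Nat.log 2 m + c) ^ c) →
      ∀ ι : MatIdx m → MatIdx (m + e), StrictMono ι → IsUpperSet (Set.range ι) →
        ∃ χ : Weight (MatIdx m),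
          Module.finrank ℂ (↥(highestWeightSpace (orbitCoordRep (powFormLex ℂ (m + e) m) m) (Function.extend ι χ 0)) ⧸ Submodule.comap (highestWeightSpace (orbitCoordRep (powFormLex ℂ (m + e) m) m) (Function.extend ι χ 0)).subtype (⨆ p : Weight (MatIdx (m + e)) × Weight (MatIdx (m + e)), ⨆ (_ : p.1 + p.2 = (Function.extend ι χ 0) ∧ p.1 ≠ 0 ∧ p.2 ≠ 0), highestWeightSpace (orbitCoordRep (powFormLex ℂ (m + e) m) m) p.1 * highestWeightSpace (orbitCoordRep (powFormLex ℂ (m + e) m) m) p.2)) <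
          Module.finrank ℂ (↥(highestWeightSpace (orbitCoordRep (MvPolynomial.rename toLex (perPoly (Fin m) ℂ)) m) χ) ⧸ Submodule.comap (highestWeightSpace (orbitCoordRep (MvPolynomial.rename toLex (perPoly (Fin m) ℂ)) m) χ).subtype (⨆ p : Weight (MatIdx m) × Weight (MatIdx m), ⨆ (_ : p.1 + p.2 = χ ∧ p.1 ≠ 0 ∧ p.2 ≠ 0), highestWeightSpace (orbitCoordRep (MvPolynomial.rename toLex (perPoly (Fin m) ℂ)) m) p.1 * highestWeightSpace (orbitCoordRep (MvPolynomial.rename toLex (perPoly (Fin m) ℂ)) m) p.2))) :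
    GenFlipThesis := by
  intro c m₀
  obtain ⟨m, hm₀, h1m, hwin⟩ := h c m₀
  refine ⟨m, hm₀, h1m, fun e he => ?_⟩
  obtain ⟨ι, hι, hup⟩ := exists_finalSegment (n := m) (n' := m + e) (Nat.le_add_right m e)
  obtain ⟨χ, hχ⟩ := hwin e he ι hι hup
  refine ⟨Function.extend ι χ 0, ?_⟩
  rw [finrank_blockPer_eq m e hι hup χ]
  exact hχ

end OwnFlip

end

end Summit.ValiantsHypothesis.ValiantsHypothesis.Theorems.GeneratorObstructions.GammaEquality
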